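import Mathlib
import Summits.MatrixMultiplication.Statement
import Summits.MatrixMultiplication.MatrixMultiplication.Theorems.GraphEquationsPurification
import Summits.MatrixMultiplication.MatrixMultiplication.Theorems.GraphEquationsOrderObstruction

/-!
# `I`-adic initial forms: INITIALLY ISOLATED ideals, and «purity is free» (`GraphEquations`, kernel M13)

Decomp-mm node «GraphEquations» (lens 5); attacked leaf `MultiplicityReduction` (`H_mult`), open
core `Purification` (M12).  Target of the node, VERBATIM: `_root_.MatrixMultiplication`.
The notion asked for by the writer (DECISION l.1434, t1): `I`-ADIC INITIAL FORMS of the test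
ideal, `I = (f_q)_q`.  Every `u ∈ ℂ[A,B,C]` is `G(a,b;f)` for a `G ∈ ℂ[A,B][F]` (`substF : G ↦ G(a,b;f)`,
section `liftF`); the `I`-adic initial form of order `ν` is the degree-`ν` component of `G` when
the lower ones vanish, SPECIALISED at `y = (A₀,B₀)` to `map (eval y) G_ν ∈ ℂ[F]`.
* `InitIsolatedFam u K y` (orders `ν_o ≤ K`, specialised forms with fibre `{0}` through `0`),
  `EqSystem.InitIsolatedAt` (tests), `EqSystem.IdealInitIsolatedAt` (SOME finite family in the
  test IDEAL — no cost charged), `EqAdmissibleIdealIso β K`;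
* **GLUE («purity is free»)** `weightedHomogeneousComponent_shift_substF`: at the graph point over
  ANY `y`, `(θ G(a,b;f))_{2ν} = (map (eval y) G_ν)(f)` exactly (the shift fixes every `f_q`, M14a);
  hence `EqSystem.InitIsolatedAt.pureIsolatedAt : InitIsolatedAt K y → PureIsolatedAt (2K) (graphPoint y)`;
* `not_initIsolatedFam_of_mem_pow`, `EqSystem.not_idealInitIsolatedAt_of_tests_mem_pow` (with M14a):
  the order obstruction in the `I`-adic currency;
* NEC: `EqSystem.initIsolatedAt_one_of_pureIsolatedAt_two` (converse glue at order one, by the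
  injectivity of `F ↦ f`, M12), `eqAdmissibleIdealIso_one_of_omega_lt`, `nec_eqAdmissibleIdealIso_one`.
These type the STAGED split of `Purification` (line «purisplit»): isolation-order reduction
`EqAdmissible β → ∀ β' > β, ∃ K, EqAdmissibleIdealIso β' K` and bounded-order purification
`EqAdmissibleIdealIso β K → ∀ β' > β, EqAdmissiblePure β'`.  No `sorry`.
Sources: [BurgisserClausenShokrollahi1997, Problem 16.3]; [Strassen1973]; T. Mora, EUROCAM 1982
(tangent cones / standard bases: the classical home of `I`-adic initial ideals; cited, not used).
-/

set_option linter.dupNamespace false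

noncomputable section

open scoped BigOperators

namespace Summit.MatrixMultiplication.MatrixMultiplication.Theorems.GraphEquations

open MvPolynomial
open Literature.Computability.AlgebraicComplexity

variable {n : ℕ}

/-! ## `ℂ[A,B][F]` and the substitution `F ↦ f` -/

/-- Polynomials in the `n²` variables `F_q` with coefficients in `ℂ[A,B]`. -/
abbrev FPoly (n : ℕ) : Type := MvPolynomial (Fin n × Fin n) (MvPolynomial (MatMulVars n) ℂ)

/-- `ι : ℂ[A,B] ↪ ℂ[A,B,C]`. -/
def liftAB (n : ℕ) : MvPolynomial (MatMulVars n) ℂ →+* MvPolynomial (GraphVars n) ℂ :=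
  (rename (Sum.inl : MatMulVars n → GraphVars n) :
    MvPolynomial (MatMulVars n) ℂ →ₐ[ℂ] MvPolynomial (GraphVars n) ℂ).toRingHom

/-- `ι(X_v) = a_v` resp. `b_v`. -/
@[simp] theorem liftAB_X (v : MatMulVars n) : liftAB n (X v) = X (Sum.inl v) := by
  simp [liftAB]
/-- `ι(c) = c`. -/
@[simp] theorem liftAB_C (c : ℂ) : liftAB n (C c) = C c := by
  simp [liftAB]
/-- `ι` is injective. -/
theorem liftAB_injective : Function.Injective (liftAB n) :=
  rename_injective _ Sum.inl_injective
/-- `coeff 0 (ι g) = coeff 0 g`. -/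
theorem coeff_zero_liftAB (g : MvPolynomial (MatMulVars n) ℂ) : coeff 0 (liftAB n g) = coeff 0 g :=
  constantCoeff_rename (Sum.inl : MatMulVars n → GraphVars n) g

/-- `Ψ : G(a,b;F) ↦ G(a,b;f)` — substitute the generators `f_q` for the variables `F_q`. -/
def substF (n : ℕ) : FPoly n →+* MvPolynomial (GraphVars n) ℂ :=
  eval₂Hom (liftAB n) (generator n)

/-- `Ψ(C g) = ι g`. -/
@[simp] theorem substF_C (g : MvPolynomial (MatMulVars n) ℂ) : substF n (C g) = liftAB n g := by
  simp [substF]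
/-- `Ψ(F_q) = f_q`. -/
@[simp] theorem substF_X (q : Fin n × Fin n) : substF n (X q) = generator n q := by
  simp [substF]

/-- `Ψ(g F^d) = ι(g) f^d`. -/
theorem substF_monomial (d : Fin n × Fin n →₀ ℕ) (g : MvPolynomial (MatMulVars n) ℂ) :
    substF n (monomial d g) = liftAB n g * d.prod fun q k => generator n q ^ k := by
  simp [substF, eval₂Hom_monomial]

/-- The section `c_q ↦ F_q + Σ_k a_{q₁k} b_{kq₂}`, `a, b ↦ a, b` of `Ψ`. -/
def liftF (n : ℕ) : MvPolynomial (GraphVars n) ℂ →ₐ[ℂ] FPoly n :=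
  aeval fun v : GraphVars n => Sum.elim (fun w => C (X w))
    (fun q => X q + C (∑ k : Fin n, X (Sum.inl (q.1, k)) * X (Sum.inr (k, q.2)))) v

/-- `Ψ ∘ liftF = id`: every polynomial is `G(a,b;f)` for `G = liftF u`. -/
theorem substF_liftF (u : MvPolynomial (GraphVars n) ℂ) : substF n (liftF n u) = u := by
  have h : ((substF n).comp (liftF n : MvPolynomial (GraphVars n) ℂ →+* FPoly n)) =
      RingHom.id _ := by
    refine ringHom_ext (fun c => ?_) (fun v => ?_)
    · simp [liftF]
    · rcases v with v | ⟨i, l⟩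
      · simp [liftF]
      · simp [liftF, generator, map_sum]
  exact RingHom.congr_fun h u

/-- The `F`-constant term of `liftF u` is `κ(u)` (`c ↦ ab`): `ι (constantCoeff (liftF u)) = κ(u)`. -/
theorem liftAB_constantCoeff_liftF (u : MvPolynomial (GraphVars n) ℂ) :
    liftAB n (constantCoeff (liftF n u)) = bind₁ (kappa n) u := by
  have h : ((liftAB n).comp (constantCoeff.comp
      (liftF n : MvPolynomial (GraphVars n) ℂ →+* FPoly n))) =
      (bind₁ (kappa n) : MvPolynomial (GraphVars n) ℂ →ₐ[ℂ] _).toRingHom := by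
    refine ringHom_ext (fun c => ?_) (fun v => ?_)
    · simp [liftF]
    · rcases v with v | ⟨i, l⟩
      · simp [liftF, kappa]
      · simp [liftF, kappa, map_sum]
  exact RingHom.congr_fun h u

/-- A polynomial vanishing on the graph has `I`-adic order `≥ 1`: the `F`-constant term of
`liftF u` vanishes. -/
theorem homogeneousComponent_zero_liftF_eq_zero {u : MvPolynomial (GraphVars n) ℂ}
    (hu : ∀ x ∈ mmGraph n, eval x u = 0) : homogeneousComponent 0 (liftF n u) = 0 := by
  have h0 : constantCoeff (liftF n u) = 0 := by
    apply liftAB_injective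
    rw [liftAB_constantCoeff_liftF, bind₁_kappa_eq_zero_of_vanishing hu, map_zero]
  rw [homogeneousComponent_zero, ← constantCoeff_eq, h0, C_0]

/-! ## The shift acts on coefficients only -/

/-- `τ_y : g(a, b) ↦ g(a + A₀, b + B₀)` on `ℂ[A,B]`, `y = (A₀, B₀)`. -/
def shiftAB (y : MatMulVars n → ℂ) : MvPolynomial (MatMulVars n) ℂ →+* MvPolynomial (MatMulVars n) ℂ :=
  (bind₁ fun v : MatMulVars n => X v + C (y v) :
    MvPolynomial (MatMulVars n) ℂ →ₐ[ℂ] MvPolynomial (MatMulVars n) ℂ).toRingHom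

/-- `τ_y(X_v) = X_v + y_v`. -/
@[simp] theorem shiftAB_X (y : MatMulVars n → ℂ) (v : MatMulVars n) :
    shiftAB y (X v) = X v + C (y v) := by
  simp [shiftAB]
/-- `τ_y(c) = c`. -/
@[simp] theorem shiftAB_C (y : MatMulVars n → ℂ) (c : ℂ) : shiftAB y (C c) = C c := by
  simp [shiftAB]

/-- `constantCoeff ∘ τ_y = eval y`. -/
theorem constantCoeff_comp_shiftAB (y : MatMulVars n → ℂ) :
    constantCoeff.comp (shiftAB y) = (eval y : MvPolynomial (MatMulVars n) ℂ →+* ℂ) := by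
  refine ringHom_ext (fun c => ?_) (fun v => ?_)
  · simp
  · simp

/-- `θ_{(A₀,B₀,A₀B₀)} ∘ ι = ι ∘ τ_{(A₀,B₀)}`. -/
theorem bind₁_shift_liftAB (y : MatMulVars n → ℂ) (g : MvPolynomial (MatMulVars n) ℂ) :
    bind₁ (shift (graphPoint y)) (liftAB n g) = liftAB n (shiftAB y g) := by
  have h : ((bind₁ (shift (graphPoint y)) :
      MvPolynomial (GraphVars n) ℂ →ₐ[ℂ] _).toRingHom.comp (liftAB n)) =
      (liftAB n).comp (shiftAB y) := by
    refine ringHom_ext (fun c => ?_) (fun v => ?_)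
    · simp
    · simp [shift, graphPoint]
  exact RingHom.congr_fun h g

/-- **`θ_x ∘ Ψ = Ψ ∘ map τ_y`** (`x = graphPoint y`): the shift moves the coefficients and fixes
every `f_q` (M14a `bind₁_shift_generator`). -/
theorem bind₁_shift_substF (y : MatMulVars n → ℂ) (G : FPoly n) :
    bind₁ (shift (graphPoint y)) (substF n G) = substF n (map (shiftAB y) G) := by
  have h : ((bind₁ (shift (graphPoint y)) :
      MvPolynomial (GraphVars n) ℂ →ₐ[ℂ] _).toRingHom.comp (substF n)) =
      (substF n).comp (map (shiftAB y)) := by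
    refine ringHom_ext (fun g => ?_) (fun q => ?_)
    · simp [bind₁_shift_liftAB]
    · simp [bind₁_shift_generator (graphPoint_mem_mmGraph y)]
  exact RingHom.congr_fun h G

/-! ## Weighted components of `G(a,b;f)`: purity is free -/

/-- `f^d` is weighted homogeneous of weight `2|d|`. -/
theorem isWeightedHomogeneous_prod_generator (d : Fin n × Fin n →₀ ℕ) :
    IsWeightedHomogeneous (gw n) (d.prod fun q k => generator n q ^ k) (2 * d.degree) := by
  rw [Finsupp.prod, Finsupp.degree_apply, Finset.mul_sum]
  refine IsWeightedHomogeneous.prod _ _ _ fun q _ => ?_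
  have h := (isWeightedHomogeneous_generator q).pow (d q)
  simpa [smul_eq_mul, mul_comm] using h

/-- `homogeneousComponent` commutes with a change of coefficients. -/
theorem homogeneousComponent_map {R S σ : Type*} [CommSemiring R] [CommSemiring S] (φ : R →+* S)
    (j : ℕ) (G : MvPolynomial σ R) :
    homogeneousComponent j (map φ G) = map φ (homogeneousComponent j G) := by
  classical
  ext d
  simp only [coeff_homogeneousComponent, coeff_map]
  split_ifs <;> simp

/-- **The weight-`2ν` component of `G(a,b;f)`** when the components of `G` below `ν` vanish:
`(G(a,b;f))_{2ν} = Σ_{|d| = ν} g_d(0) f^d = (map constantCoeff G_ν)(f)`. -/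
theorem weightedHomogeneousComponent_substF {G : FPoly n} {ν : ℕ}
    (hG : ∀ j < ν, homogeneousComponent j G = 0) :
    weightedHomogeneousComponent (gw n) (2 * ν) (substF n G) =
      aeval (generator n) (map constantCoeff (homogeneousComponent ν G)) := by
  classical
  have hcoeff : ∀ d : Fin n × Fin n →₀ ℕ, d.degree < ν → coeff d G = 0 := fun d hd => by
    have h := congrArg (coeff d) (hG _ hd)
    rwa [coeff_homogeneousComponent, if_pos rfl, coeff_zero] at h
  conv_lhs => rw [G.as_sum, map_sum, map_sum]
  rw [homogeneousComponent_apply, map_sum, map_sum, Finset.sum_filter]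
  refine Finset.sum_congr rfl fun d _ => ?_
  rw [substF_monomial, weightedHomogeneousComponent_mul]
  simp_rw [weightedHomogeneousComponent_of_mem (isWeightedHomogeneous_prod_generator d)]
  by_cases hdeg : d.degree = ν
  · rw [if_pos hdeg, Finset.sum_eq_single (0, 2 * ν)]
    · rw [if_pos (by rw [hdeg]), weightedHomogeneousComponent_zero _ gw_ne_zero, coeff_zero_liftAB,
        map_monomial, aeval_monomial, algebraMap_eq, constantCoeff_eq]
    · intro ij hij hne
      rw [Finset.HasAntidiagonal.mem_antidiagonal] at hij
      by_cases h2 : ij.2 = 2 * d.degree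
      · exfalso; apply hne
        have h1 : ij.1 = 0 := by omega
        exact Prod.ext h1 (by rw [h2, hdeg])
      · rw [if_neg h2, mul_zero]
    · intro h
      exfalso; apply h
      rw [Finset.HasAntidiagonal.mem_antidiagonal]
      simp
  · rw [if_neg hdeg]
    rcases lt_or_gt_of_ne hdeg with hlt | hgt
    · rw [hcoeff d hlt, map_zero]
      simp
    · refine Finset.sum_eq_zero fun ij hij => ?_
      rw [Finset.HasAntidiagonal.mem_antidiagonal] at hij
      have h2 : ij.2 ≠ 2 * d.degree := by omega
      rw [if_neg h2, mul_zero]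

/-- **GLUE («purity is free»).**  If the components of `G` below `ν` vanish then, at the graph
point over ANY `y`, the weight-`2ν` component of the shifted `G(a,b;f)` is the PURE form
`(map (eval y) G_ν)(f)` — the specialised `I`-adic initial form with `F ↦ f`. -/
theorem weightedHomogeneousComponent_shift_substF (y : MatMulVars n → ℂ) {G : FPoly n} {ν : ℕ}
    (hG : ∀ j < ν, homogeneousComponent j G = 0) :
    weightedHomogeneousComponent (gw n) (2 * ν) (bind₁ (shift (graphPoint y)) (substF n G)) =
      aeval (generator n) (map (eval y) (homogeneousComponent ν G)) := by
  have hG' : ∀ j < ν, homogeneousComponent j (map (shiftAB y) G) = 0 := fun j hj => by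
    rw [homogeneousComponent_map, hG j hj, map_zero]
  rw [bind₁_shift_substF, weightedHomogeneousComponent_substF hG', homogeneousComponent_map,
    map_map, constantCoeff_comp_shiftAB]

/-! ## Initially isolated families, systems, ideals -/

/-- **INITIALLY ISOLATED to order `K` over `y`** (a finite family `u`): `u_o = G_o(a,b;f)` with the
components of `G_o` below `ν_o ≤ K` vanishing, and the specialised initial forms
`P_o = map (eval y) (G_o)_{ν_o} ∈ ℂ[F]` have fibre `{0}` through `0`. -/
def InitIsolatedFam {T : ℕ} (u : Fin T → MvPolynomial (GraphVars n) ℂ) (K : ℕ)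
    (y : MatMulVars n → ℂ) : Prop :=
  ∃ (ν : Fin T → ℕ) (G : Fin T → FPoly n),
    (∀ o, ν o ≤ K) ∧ (∀ o, substF n (G o) = u o) ∧
    (∀ o, ∀ j < ν o, homogeneousComponent j (G o) = 0) ∧
    (∀ F₀ : Fin n × Fin n → ℂ,
      (∀ o, eval F₀ (map (eval y) (homogeneousComponent (ν o) (G o))) =
          eval 0 (map (eval y) (homogeneousComponent (ν o) (G o)))) → F₀ = 0)

namespace EqSystem

/-- The TESTS of `E` are initially isolated to order `K` over `y`. -/
def InitIsolatedAt (E : EqSystem n) (K : ℕ) (y : MatMulVars n → ℂ) : Prop :=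
  InitIsolatedFam (fun o : Fin E.tests.length => E.testPoly (E.tests.get o)) K y

/-- The test IDEAL of `E` is initially isolated to order `K` over `y`: SOME finite family in the
ideal of the tests is (no cost is charged for that family). -/
def IdealInitIsolatedAt (E : EqSystem n) (K : ℕ) (y : MatMulVars n → ℂ) : Prop :=
  ∃ (T : ℕ) (u : Fin T → MvPolynomial (GraphVars n) ℂ),
    (∀ i, u i ∈ Ideal.span (Set.range fun o : Fin E.tests.length => E.testPoly (E.tests.get o))) ∧
    InitIsolatedFam u K y

/-- Tests initially isolated ⇒ ideal initially isolated. -/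
theorem InitIsolatedAt.idealInitIsolatedAt {E : EqSystem n} {K : ℕ} {y : MatMulVars n → ℂ}
    (h : E.InitIsolatedAt K y) : E.IdealInitIsolatedAt K y :=
  ⟨E.tests.length, _, fun o => Ideal.subset_span ⟨o, rfl⟩, h⟩

end EqSystem

/-- `EqAdmissibleIdealIso β K`: correct systems of cost `O(n^β)` whose test ideal is initially
isolated to order `K` over some `(A₀, B₀)` exist for all `n ≥ 1`. -/
def EqAdmissibleIdealIso (β : ℝ) (K : ℕ) : Prop :=
  ∃ c : ℝ, ∀ n : ℕ, 1 ≤ n → ∃ E : EqSystem n, E.Correct ∧ (∃ y, E.IdealInitIsolatedAt K y) ∧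
    (E.cost : ℝ) ≤ c * (n : ℝ) ^ β

/-! ## Purity is free: initially isolated ⇒ pure isolated of twice the order -/

/-- **An initially isolated family has PURE ISOLATED weighted initial forms of order `2K` at the
graph point over `y`** — with no genericity hypothesis. -/
theorem InitIsolatedFam.pure {T : ℕ} {u : Fin T → MvPolynomial (GraphVars n) ℂ} {K : ℕ}
    {y : MatMulVars n → ℂ} (h : InitIsolatedFam u K y) :
    ∃ (m : Fin T → ℕ) (P : Fin T → MvPolynomial (Fin n × Fin n) ℂ),
      (∀ o, m o ≤ 2 * K) ∧
      (∀ o, weightedHomogeneousComponent (gw n) (m o) (bind₁ (shift (graphPoint y)) (u o)) =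
        aeval (generator n) (P o)) ∧
      (∀ F₀ : Fin n × Fin n → ℂ, (∀ o, eval F₀ (P o) = eval 0 (P o)) → F₀ = 0) := by
  obtain ⟨ν, G, hν, hG, hlow, hiso⟩ := h
  refine ⟨fun o => 2 * ν o, fun o => map (eval y) (homogeneousComponent (ν o) (G o)),
    fun o => by show 2 * ν o ≤ 2 * K; have := hν o; omega, fun o => ?_, hiso⟩
  rw [← hG o, weightedHomogeneousComponent_shift_substF y (hlow o)]

/-- **`InitIsolatedAt K y → PureIsolatedAt (2K) (graphPoint y)`.** -/
theorem EqSystem.InitIsolatedAt.pureIsolatedAt {E : EqSystem n} {K : ℕ} {y : MatMulVars n → ℂ}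
    (h : E.InitIsolatedAt K y) : E.PureIsolatedAt (2 * K) (graphPoint y) :=
  InitIsolatedFam.pure h

/-- Hence `InitIsolatedAt K y → PureIsolated (2K)`. -/
theorem EqSystem.InitIsolatedAt.pureIsolated {E : EqSystem n} {K : ℕ} {y : MatMulVars n → ℂ}
    (h : E.InitIsolatedAt K y) : E.PureIsolated (2 * K) :=
  ⟨graphPoint y, graphPoint_mem_mmGraph y, h.pureIsolatedAt⟩

/-! ## The order obstruction in the `I`-adic currency -/

/-- **A family in `I^e` is not initially isolated to any order `K < e`** (`n ≥ 1`). -/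
theorem not_initIsolatedFam_of_mem_pow (hn : 1 ≤ n) {T : ℕ} {u : Fin T → MvPolynomial (GraphVars n) ℂ}
    {K e : ℕ} (hK : K < e) (hu : ∀ o, u o ∈ graphIdeal n ^ e) (y : MatMulVars n → ℂ) :
    ¬ InitIsolatedFam u K y := by
  intro h
  obtain ⟨m, P, hm, hinit, hiso⟩ := h.pure
  have hP : ∀ o, P o = 0 := fun o => by
    apply aeval_generator_injective
    rw [← hinit o, map_zero]
    exact weightedHomogeneousComponent_shift_eq_zero_of_mem_pow (graphPoint_mem_mmGraph y) (hu o)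
      (by have := hm o; omega)
  have h1 := hiso (fun _ => 1) (fun o => by simp [hP o])
  have h2 := congr_fun h1 (⟨0, hn⟩, ⟨0, hn⟩)
  simp at h2

/-- **A system whose tests lie in `I^e` has no initially isolated test IDEAL of order `< e`.** -/
theorem EqSystem.not_idealInitIsolatedAt_of_tests_mem_pow (hn : 1 ≤ n) {E : EqSystem n} {K e : ℕ}
    (hK : K < e) (hE : ∀ o : Fin E.tests.length, E.testPoly (E.tests.get o) ∈ graphIdeal n ^ e)
    (y : MatMulVars n → ℂ) : ¬ E.IdealInitIsolatedAt K y := by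
  rintro ⟨T, u, hu, hiso⟩
  have hle : Ideal.span (Set.range fun o : Fin E.tests.length => E.testPoly (E.tests.get o)) ≤
      graphIdeal n ^ e :=
    Ideal.span_le.mpr (by rintro _ ⟨o, rfl⟩; exact hE o)
  exact not_initIsolatedFam_of_mem_pow hn hK (fun i => hle (hu i)) y hiso

/-! ## NEC: order one from reducedness -/

namespace EqSystem

/-- **Converse glue at order one.**  A system whose tests vanish on the graph and which is pure
isolated of order `2` at the graph point over `y` is initially isolated to order `1` over `y`
(take `G_o = liftF t_o`; its `F`-constant term vanishes, and its specialised linear form is the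
pure weight-`2` form by the glue identity and the injectivity of `F ↦ f`). -/
theorem initIsolatedAt_one_of_pureIsolatedAt_two {E : EqSystem n}
    (hE : ∀ o : Fin E.tests.length, ∀ x ∈ mmGraph n, eval x (E.testPoly (E.tests.get o)) = 0)
    {y : MatMulVars n → ℂ} (h : E.PureIsolatedAt 2 (graphPoint y)) : E.InitIsolatedAt 1 y := by
  classical
  obtain ⟨m, P, hm, hinit, hiso⟩ := h
  -- order-`< 2` components of the shifted tests vanish (the tests lie in `I`)
  have hvan : ∀ o, ∀ j < 2, weightedHomogeneousComponent (gw n) j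
      (bind₁ (shift (graphPoint y)) (E.testPoly (E.tests.get o))) = 0 := fun o j hj =>
    weightedHomogeneousComponent_shift_eq_zero_of_mem_pow (e := 1) (graphPoint_mem_mmGraph y)
      (by rw [pow_one]; exact mem_graphIdeal_of_vanishing (hE o)) (by omega)
  have hlow : ∀ o, ∀ j < 1, homogeneousComponent j (liftF n (E.testPoly (E.tests.get o))) = 0 :=
    fun o j hj => by
      obtain rfl : j = 0 := by omega
      exact homogeneousComponent_zero_liftF_eq_zero (hE o)
  -- the specialised linear forms ARE the pure weight-2 forms whenever `m o = 2`, else `P o = 0`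
  have hP2 : ∀ o, m o = 2 → map (eval y) (homogeneousComponent 1 (liftF n (E.testPoly (E.tests.get o)))) = P o :=
    fun o ho => by
      apply aeval_generator_injective
      rw [← hinit o, ho, ← weightedHomogeneousComponent_shift_substF y (hlow o), substF_liftF]
  have hP0 : ∀ o, m o ≠ 2 → P o = 0 := fun o ho => by
    apply aeval_generator_injective
    rw [← hinit o, map_zero]
    exact hvan o _ (by have := hm o; omega)
  refine ⟨fun _ => 1, fun o => liftF n (E.testPoly (E.tests.get o)), fun _ => le_rfl,
    fun o => substF_liftF _, hlow, fun F₀ hF => hiso F₀ fun o => ?_⟩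
  by_cases ho : m o = 2
  · rw [← hP2 o ho]; exact hF o
  · simp [hP0 o ho]

end EqSystem

/-- `graphPoint 0 = 0`. -/
theorem graphPoint_zero : graphPoint (0 : MatMulVars n → ℂ) = 0 := by
  funext v
  rcases v with v | ⟨i, l⟩ <;> simp [graphPoint]

/-- **NEC, unconditionally above `ω`:** `ω < β → EqAdmissibleIdealIso β 1` (generator systems are
reduced at the origin, M2; reduced ⇒ pure isolated of order `2`, M9b; converse glue). -/
theorem eqAdmissibleIdealIso_one_of_omega_lt {β : ℝ} (hβ : omega ℂ < β) : EqAdmissibleIdealIso β 1 := by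
  obtain ⟨c, hc⟩ := exists_correct_reducedAt_zero_of_omega_lt hβ
  refine ⟨c, fun n hn => ?_⟩
  obtain ⟨E, hE, h0, hcost⟩ := hc n hn
  refine ⟨E, hE, ⟨0, ?_⟩, hcost⟩
  have hpure : E.PureIsolatedAt 2 (graphPoint 0) := by
    rw [graphPoint_zero]
    exact EqSystem.pureIsolatedAt_two_of_reducedAt hE (zero_mem_mmGraph n) h0
  exact (EqSystem.initIsolatedAt_one_of_pureIsolatedAt_two
    (fun o x hx => hE.eval_testPoly_eq_zero hx (List.get_mem _ _)) hpure).idealInitIsolatedAt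

/-- `EqAdmissibleIdealIso (5/2) 1`, unconditionally. -/
theorem eqAdmissibleIdealIso_five_halves : EqAdmissibleIdealIso (5 / 2) 1 :=
  eqAdmissibleIdealIso_one_of_omega_lt (lt_trans (BCS1997_cor_15_33 ℂ) (by norm_num))

/-- **NEC:** `S → ∀ β > 2, EqAdmissibleIdealIso β 1`. -/
theorem nec_eqAdmissibleIdealIso_one (hS : _root_.MatrixMultiplication) {β : ℝ} (hβ : 2 < β) :
    EqAdmissibleIdealIso β 1 := by
  refine eqAdmissibleIdealIso_one_of_omega_lt ?_
  have h : omega ℂ = 2 := hS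
  rw [h]; exact hβ

end Summit.MatrixMultiplication.MatrixMultiplication.Theorems.GraphEquations
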